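import Summits.CriticalPhenomena.SAWScalingLimit.Theses.SAWMassiveIsingTilt
import Summits.CriticalPhenomena.SAWScalingLimit.Theorems.SAWMassiveIsingTiltTiltLawBasic
import Summits.CriticalPhenomena.SAWScalingLimit.Theorems.SAWMassiveIsingTiltMassiveWindowSLEStubZloopRatioMixingCore
import Summits.CriticalPhenomena.SAWScalingLimit.Theorems.SAWMassiveIsingTiltMassiveWindowSLEStubWindowDiscrepancyGeometry
import Summits.CriticalPhenomena.SAWScalingLimit.Theorems.SAWMassiveIsingTiltMassiveWindowSLEStubWindowNesting
import HarnessLib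

/-!
# Crux `MassiveWindowSLE` (stmt-CriticalPhenomena-7685), line `registered`, skeleton r8 —
# stub F3 `stub_zloopRateRatioMixing` (M''): RATE-form window ratio mixing of the loop-gas bath

Route `route-CriticalPhenomena-SAWMassiveIsingTilt` (CriticalPhenomena / SAWScalingLimit). Third and
last registered piece of the engine of the line, after F1 `stub_zloopMixingEdgeBound` (one attachment
edge) and F2 `stub_zloopRatioMixingCore` (the fixed-mesh core; landed, imported). `Zloop H S y`
(`Theorems/SAWMassiveIsingTiltDefs.lean`) is the loop-`O(1)` partition function of `H` read inside `S`.

**F3 = M''.** For every window schedule `m` (fast: `mδ·δ → 0`, `m/log δ⁻¹ → ∞`) with an intrinsic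
subcritical RATE `c` (`c(δ)/(δ log δ⁻¹) → ∞` and, eventually, the uniform finite-volume bound
`W_Λ(u, v) ≤ e^{-c(δ)·|c(u) − c(v)|}·Zloop_Λ` on the honeycomb lattice at the window weight
`y(δ) = 1/√3 − m(δ)δ`), every hull pair `D' ⊆ D`, `ε, θ > 0` and all small `δ`, uniformly in the
endpoints and in two `Ω'_δ`-SAWs `γ₁, γ₂` whose polylines are `ε`-away from `K = cl (D ∖ D')`:
`Z(γ₁ᶜ)·Z'(γ₂ᶜ) ≤ (1 + θ)·Z'(γ₁ᶜ)·Z(γ₂ᶜ)`, `Z = Zloop(Ω_δ)`, `Z' = Zloop(Ω'_δ)` read off the walk.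

Proof (bookkeeping around F2). Mgeo (`stub_windowDiscrepancyGeometry`, landed) supplies the counting
constant `C₀` (`#{w : dist (c w) z ≤ ρ} ≤ C₀(ρ+1)²`) and, eventually in `δ`, `H' = Ω'_δ ≤ H = Ω_δ`
and the discrepancy clause (every `H`-edge at an `Ω'_δ`-vertex missing from `H'` is within `δ` of
`K`). Counting (`mix_card_edgeSet_le`): `#E(Ω_δ) ≤ (C₀(R/δ + 1)²)²` since `D ⊆ cl B(0, R)`. Eventually
`0 ≤ y(δ) ≤ 3/5`, `16δ ≤ ε` and `c(δ) ≥ (80/ε)·δ log δ⁻¹`, so `e^{-c(δ)ε/(8δ)} ≤ δ^{10}` beats the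
polynomial prefactor `≤ C δ⁻⁸`: the F2 threshold `#E(H)·18 (C₀(ε/(4δ)+1)²)² e^{-cε/(8δ)} ≤ C δ² ≤
log(1 + θ)` holds eventually. Then F2 with `K = cl (D ∖ D')`, `V' = Ω'_δ`, `S_j = (supp γ_j)ᶜ`:
non-trivial walks of `Ω'_δ` live on `Ω'_δ` (`mix_support_mem`) and their support vertices are
`ε`-far from `K` (`wn_support_far_of_curve_mem`); trivial walks `a = b` make the claim an identity
(`1 ≤ Zloop`, `one_le_zloop`).

References: G. F. Lawler, O. Schramm, W. Werner, *Conformal restriction: the chordal case*, J. Amer.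
Math. Soc. 16 (2003) 917–955, §3 [LawlerSchrammWerner2003Restriction]; H. Duminil-Copin, S. Smirnov,
Ann. of Math. 175 (2012), §4 (discrete domains `Ω_δ` of the honeycomb lattice)
[DuminilCopinSmirnov2012]; S. Friedli, Y. Velenik, *Statistical Mechanics of Lattice Systems*
(CUP 2017), §3.7 [FriedliVelenik2017]. No new facts are cited.
-/

noncomputable section

namespace Summit.CriticalPhenomena.SAWScalingLimit.Theorems.MassiveWindowSLE.Birth

open scoped BigOperators Topology Classical MeasureTheory NNReal ENNReal
open Filter Set MeasureTheory
open Literature.Probability Literature.Probability.LatticeModels Literature.Probability.RandomPlanarGeometry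
open Summit.CriticalPhenomena.SAWScalingLimit.Theorems.SAWMassiveIsingTilt

/-! ### Walks of `Ω_δ` and counting -/

/-- The support of a non-trivial SAW of `Ω_δ` lies in the discrete domain `Ω_δ` (every support
vertex lies on an edge of the walk, and edges of `Ω_δ` join vertices of `Ω_δ`). -/
theorem mix_support_mem {Ω : Set ℂ} {δ : ℝ} {a b : HexVertex} (γ : SAW.HexDomainSAW Ω δ a b)
    (hab : a ≠ b) : ∀ v ∈ γ.walk.support, v ∈ SAW.embMeshDomain hexGraph hexCenter Ω δ := by
  intro v hv
  have hnil : ¬ γ.walk.Nil := fun h => hab h.eq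
  obtain ⟨e, he, hve⟩ :=
    (SimpleGraph.Walk.mem_support_iff_exists_mem_edges_of_not_nil hnil).1 hv
  have he' := SimpleGraph.Walk.edges_subset_edgeSet γ.walk he
  revert he' hve
  induction e using Sym2.ind with
  | h p q =>
    intro hve he'
    have hadj := (SAW.embDomainGraph_adj_iff hexGraph hexCenter).1
      ((SimpleGraph.mem_edgeSet _).1 he')
    rcases Sym2.mem_iff.1 hve with h | h
    · rw [h]; exact hadj.2.1
    · rw [h]; exact hadj.2.2

/-- Counting the edges of `Ω_δ`: both endpoints of an edge are mesh points of `Ω ⊆ cl B(0, R)`,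
whose centres lie in the ball of radius `R/δ`, which contains `≤ C₀ (R/δ + 1)²` honeycomb
vertices. -/
theorem mix_card_edgeSet_le {C₀ : ℝ}
    (hC₀ : ∀ (z : ℂ) (ρ : ℝ), 0 ≤ ρ →
      {w : HexVertex | dist (hexCenter w) z ≤ ρ}.Finite ∧
        (({w : HexVertex | dist (hexCenter w) z ≤ ρ}.ncard : ℝ) ≤ C₀ * (ρ + 1) ^ 2))
    {Ω : Set ℂ} {R : ℝ} (hR : ∀ z ∈ Ω, ‖z‖ ≤ R) (hR0 : 0 ≤ R) {δ : ℝ} (hδ : 0 < δ)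
    (hfin : (SAW.hexDomainGraph Ω δ).edgeSet.Finite) :
    (((SAW.hexDomainGraph Ω δ).edgeSet.ncard : ℕ) : ℝ) ≤ (C₀ * (R / δ + 1) ^ 2) ^ 2 := by
  rw [Set.ncard_eq_toFinset_card _ hfin]
  obtain ⟨hNfin, hNcard⟩ := hC₀ 0 (R / δ) (by positivity)
  set N : Finset HexVertex := hNfin.toFinset with hNdef
  have hV : ∀ w, w ∈ SAW.embMeshDomain hexGraph hexCenter Ω δ → w ∈ N := by
    intro w hw
    rw [hNdef, Set.Finite.mem_toFinset, Set.mem_setOf_eq, dist_zero_right]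
    have h := hR _ (SAW.embMeshDomain_subset _ _ _ _ hw)
    rw [norm_mul, Complex.norm_real, Real.norm_of_nonneg hδ.le] at h
    rw [le_div_iff₀ hδ]
    linarith
  have hsub : hfin.toFinset ⊆ (N ×ˢ N).image (fun p : HexVertex × HexVertex => s(p.1, p.2)) := by
    intro e he
    rw [Set.Finite.mem_toFinset] at he
    revert he
    induction e using Sym2.ind with
    | h a b =>
      intro he
      have hab := (SAW.embDomainGraph_adj_iff hexGraph hexCenter).1
        ((SimpleGraph.mem_edgeSet _).1 he)
      exact Finset.mem_image.2 ⟨(a, b), Finset.mem_product.2 ⟨hV a hab.2.1, hV b hab.2.2⟩, rfl⟩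
  have hNc : (N.card : ℝ) ≤ C₀ * (R / δ + 1) ^ 2 := by
    rw [hNdef, ← Set.ncard_eq_toFinset_card _ hNfin]
    exact hNcard
  calc ((hfin.toFinset).card : ℝ) ≤ ((N ×ˢ N).card : ℝ) := by
        exact_mod_cast (Finset.card_le_card hsub).trans Finset.card_image_le
    _ = (N.card : ℝ) * N.card := by rw [Finset.card_product, Nat.cast_mul]
    _ ≤ (C₀ * (R / δ + 1) ^ 2) * (C₀ * (R / δ + 1) ^ 2) :=
        mul_le_mul hNc hNc (Nat.cast_nonneg _) ((Nat.cast_nonneg _).trans hNc)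
    _ = (C₀ * (R / δ + 1) ^ 2) ^ 2 := by ring

/-! ### The registered stub F3 -/

/-- **Stub F3 `stub_zloopRateRatioMixing` (M'', the engine of skeleton r8): RATE-form window ratio
mixing of the loop-gas bath.** For every fast window schedule `m` (`mδ·δ → 0`, `m/log δ⁻¹ → ∞`)
with an intrinsic subcritical rate `c` (`c(δ)/(δ log δ⁻¹) → ∞` and, eventually, the uniform
finite-volume decay `W_Λ(u,v) ≤ e^{-c(δ)|c(u) − c(v)|} Zloop_Λ` at the window weight
`y(δ) = 1/√3 − m(δ)δ`), every hull pair `D' ⊆ D`, `ε, θ > 0` and all small `δ`, uniformly in the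
endpoints and in two `Ω'_δ`-SAWs whose polylines are `ε`-away from `K = cl (D ∖ D')`:
`Z(γ₁ᶜ) Z'(γ₂ᶜ) ≤ (1 + θ) Z'(γ₁ᶜ) Z(γ₂ᶜ)`. Proof: Mgeo supplies `C₀` and, eventually, `H' ≤ H`
and the discrepancy clause; `#E(Ω_δ) ≤ (C₀(R/δ+1)²)²`; eventually `0 ≤ y(δ) ≤ 3/5`, `16δ ≤ ε`,
`c(δ) ≥ (80/ε) δ log δ⁻¹` (so `e^{-c(δ)ε/(8δ)} ≤ δ^{10}`) and `C δ² ≤ log(1 + θ)`; then F2 with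
`K = cl (D ∖ D')`, `V' = Ω'_δ`, `S_j = (supp γ_j)ᶜ` (trivial walks `a = b`: an identity). -/
theorem stub_zloopRateRatioMixing :
    ∀ (m c : ℝ → ℝ), Filter.Tendsto (fun δ => m δ * δ) (nhdsWithin 0 (Set.Ioi 0)) (nhds 0) ∧ Filter.Tendsto (fun δ => m δ / Real.log δ⁻¹) (nhdsWithin 0 (Set.Ioi 0)) Filter.atTop → (Filter.Tendsto (fun δ => c δ / (δ * Real.log δ⁻¹)) (nhdsWithin 0 (Set.Ioi 0)) Filter.atTop ∧ ∀ᶠ δ in nhdsWithin 0 (Set.Ioi 0), ∀ (Λ : Finset Literature.Probability.LatticeModels.HexVertex) (u v : Literature.Probability.LatticeModels.HexVertex), u ∈ Λ → v ∈ Λ → u ≠ v → (∑ᶠ E ∈ {E : Finset (Sym2 Literature.Probability.LatticeModels.HexVertex) | (∀ e ∈ E, e ∈ (Literature.Probability.LatticeModels.hexGraph).edgeSet ∧ ∀ w ∈ e, w ∈ (↑Λ : Set Literature.Probability.LatticeModels.HexVertex)) ∧ ∀ w : Literature.Probability.LatticeModels.HexVertex, (Odd (E.filter (fun e => w ∈ e)).card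 ↔ (w = u ∨ w = v))}, ((Real.sqrt 3)⁻¹ - m δ * δ) ^ E.card) ≤ Real.exp (-(c δ * dist (Literature.Probability.LatticeModels.hexCenter u) (Literature.Probability.LatticeModels.hexCenter v))) * Summit.CriticalPhenomena.SAWScalingLimit.Theorems.SAWMassiveIsingTilt.Zloop Literature.Probability.LatticeModels.hexGraph (↑Λ : Set Literature.Probability.LatticeModels.HexVertex) ((Real.sqrt 3)⁻¹ - m δ * δ)) → ∀ (D D' : Literature.Probability.RandomPlanarGeometry.DobrushinDomain), D.IsHullSubdomain D' → ∀ ε : ℝ, 0 < ε → ∀ θ : ℝ, 0 < θ → ∀ᶠ δ in nhdsWithin 0 (Set.Ioi 0), ∀ (a b : Literature.Probability.LatticeModels.HexVertex) (γ₁ γ₂ : Literature.Probability.RandomPlanarGeometry.SAW.HexDomainSAW D'.carrier δ a b), γ₁.curve ∈ {γ : Literature.Probability.RandomPlanarGeometry.CurveClass ℂ | ∀ z ∈ γ.range, ∀ k ∈ closure (D.carrier \ D'.carrier), ε < dist z k} → γ₂.curve ∈ {γ : Literature.Probability.RandomPlanarGeometry.CurveClass ℂ | ∀ z ∈ γ.range,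 ∀ k ∈ closure (D.carrier \ D'.carrier), ε < dist z k} → Summit.CriticalPhenomena.SAWScalingLimit.Theorems.SAWMassiveIsingTilt.Zloop (Literature.Probability.RandomPlanarGeometry.SAW.hexDomainGraph D.carrier δ) {v | v ∉ γ₁.walk.support} ((Real.sqrt 3)⁻¹ - m δ * δ) * Summit.CriticalPhenomena.SAWScalingLimit.Theorems.SAWMassiveIsingTilt.Zloop (Literature.Probability.RandomPlanarGeometry.SAW.hexDomainGraph D'.carrier δ) {v | v ∉ γ₂.walk.support} ((Real.sqrt 3)⁻¹ - m δ * δ) ≤ (1 + θ) * (Summit.CriticalPhenomena.SAWScalingLimit.Theorems.SAWMassiveIsingTilt.Zloop (Literature.Probability.RandomPlanarGeometry.SAW.hexDomainGraph D'.carrier δ) {v | v ∉ γ₁.walk.support} ((Real.sqrt 3)⁻¹ - m δ * δ) * Summit.CriticalPhenomena.SAWScalingLimit.Theorems.SAWMassiveIsingTilt.Zloop (Literature.Probability.RandomPlanarGeometry.SAW.hexDomainGraph D.carrier δ) {v | v ∉ γ₂.walk.support} ((Real.sqrt 3)⁻¹ - m δ * δ)) := by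
  intro m c hfast hrate D D' hDD' ε hε θ hθ
  obtain ⟨C₀, hC₀⟩ := stub_windowDiscrepancyGeometry.1
  obtain ⟨R₀, hR₀⟩ := D.isBounded.exists_norm_le
  set R : ℝ := max R₀ 0 with hRdef
  have hR : ∀ z ∈ D.carrier, ‖z‖ ≤ R := fun z hz => (hR₀ z hz).trans (le_max_left _ _)
  have hR0 : 0 ≤ R := le_max_right _ _
  have hC₀0 : 0 ≤ C₀ := by
    have h := (hC₀ 0 0 le_rfl).2
    have h0 : (0 : ℝ) ≤ ({w : HexVertex | dist (hexCenter w) 0 ≤ 0}.ncard : ℝ) := Nat.cast_nonneg _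
    linarith
  have hlogθ : 0 < Real.log (1 + θ) := Real.log_pos (by linarith)
  -- the constant of the polynomial prefactor
  set M : ℝ := (C₀ * (R + 1) ^ 2) ^ 2 * (18 * (C₀ * (ε / 4 + 1) ^ 2) ^ 2) with hMdef
  have hlim : Tendsto (fun δ : ℝ => M * δ ^ 2) (𝓝[>] 0) (𝓝 0) := by
    have h : Tendsto (fun δ : ℝ => M * δ ^ 2) (𝓝 0) (𝓝 (M * 0 ^ 2)) :=
      (continuous_const.mul (continuous_pow 2)).tendsto 0
    rw [zero_pow two_ne_zero, mul_zero] at h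
    exact h.mono_left nhdsWithin_le_nhds
  have hs3 : (Real.sqrt 3)⁻¹ < 3 / 5 := by
    have h : (5 : ℝ) / 3 < Real.sqrt 3 := by
      rw [Real.lt_sqrt (by norm_num)]
      norm_num
    rw [inv_lt_comm₀ (by positivity) (by norm_num)]
    calc (3 / 5 : ℝ)⁻¹ = 5 / 3 := by norm_num
      _ < Real.sqrt 3 := h
  have hs0 : (0 : ℝ) < (Real.sqrt 3)⁻¹ := by positivity
  filter_upwards [stub_windowDiscrepancyGeometry.2 D D' hDD', hrate.2,
    hrate.1.eventually_ge_atTop (80 / ε),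
    hfast.1.eventually_mem (Ioo_mem_nhds (show (Real.sqrt 3)⁻¹ - 3 / 5 < 0 by linarith) hs0),
    mem_nhdsWithin_of_mem_nhds (Iio_mem_nhds one_pos),
    mem_nhdsWithin_of_mem_nhds (Iio_mem_nhds (show (0 : ℝ) < ε / 16 by positivity)),
    hlim.eventually (eventually_lt_nhds hlogθ), self_mem_nhdsWithin]
    with δ hgeoδ hrateδ hcδ hmδ hδ1 hδε hMδ hδ
  rw [Set.mem_Ioi] at hδ
  rw [Set.mem_Iio] at hδ1 hδε
  have hδ0 : δ ≠ 0 := hδ.ne'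
  intro a b γ₁ γ₂ hγ₁ hγ₂
  have hy0 : 0 ≤ (Real.sqrt 3)⁻¹ - m δ * δ := by linarith [hmδ.2]
  have hy1 : (Real.sqrt 3)⁻¹ - m δ * δ ≤ 3 / 5 := by linarith [hmδ.1]
  have hHfin := finite_edgeSet_hexDomainGraph D.isBounded hδ0
  -- the trivial case of a trivial walk
  by_cases hab : a = b
  · subst hab
    have h1 : γ₁.walk.support = [a] :=
      SimpleGraph.Walk.nil_iff_support_eq.1 (SimpleGraph.Walk.isPath_iff_nil.1 γ₁.isPath)
    have h2 : γ₂.walk.support = [a] :=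
      SimpleGraph.Walk.nil_iff_support_eq.1 (SimpleGraph.Walk.isPath_iff_nil.1 γ₂.isPath)
    have hS : {v : HexVertex | v ∉ γ₁.walk.support} = {v : HexVertex | v ∉ γ₂.walk.support} := by
      rw [h1, h2]
    rw [hS]
    have hZa := one_le_zloop D.isBounded hδ0 hy0 {v : HexVertex | v ∉ γ₂.walk.support}
    have hZb := one_le_zloop D'.isBounded hδ0 hy0 {v : HexVertex | v ∉ γ₂.walk.support}
    nlinarith [mul_nonneg (zero_le_one.trans hZa) (zero_le_one.trans hZb), hθ]
  -- rate positivity and the smallness of the total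
  have hL : 0 < Real.log δ⁻¹ := Real.log_pos ((one_lt_inv₀ hδ).2 hδ1)
  have hδL : 0 < δ * Real.log δ⁻¹ := mul_pos hδ hL
  have hc1 : 80 / ε * (δ * Real.log δ⁻¹) ≤ c δ := (le_div_iff₀ hδL).1 hcδ
  have hc0 : 0 ≤ c δ := le_trans (by positivity) hc1
  have hexp : Real.exp (-(c δ * (ε / (8 * δ)))) ≤ δ ^ 10 := by
    have h10 : 10 * Real.log δ⁻¹ ≤ c δ * (ε / (8 * δ)) := by
      calc 10 * Real.log δ⁻¹ = 80 / ε * (δ * Real.log δ⁻¹) * (ε / (8 * δ)) := by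
            field_simp
            ring
        _ ≤ c δ * (ε / (8 * δ)) := mul_le_mul_of_nonneg_right hc1 (by positivity)
    calc Real.exp (-(c δ * (ε / (8 * δ)))) ≤ Real.exp (-(10 * Real.log δ⁻¹)) :=
          Real.exp_le_exp.2 (neg_le_neg h10)
      _ = δ ^ 10 := by
          rw [Real.log_inv, show -(10 * -Real.log δ) = ((10 : ℕ) : ℝ) * Real.log δ by
            push_cast; ring, Real.exp_nat_mul, Real.exp_log hδ]
  have hNE := mix_card_edgeSet_le hC₀ hR hR0 hδ hHfin
  have hT : (C₀ * (R / δ + 1) ^ 2) ^ 2 *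
      (18 * (C₀ * (ε / (4 * δ) + 1) ^ 2) ^ 2 * Real.exp (-(c δ * (ε / (8 * δ))))) ≤
      Real.log (1 + θ) := by
    have h1δ : (1 : ℝ) ≤ 1 / δ := by
      rw [le_div_iff₀ hδ]
      linarith
    have hA1 : R / δ + 1 ≤ (R + 1) / δ := by
      calc R / δ + 1 ≤ R / δ + 1 / δ := by linarith
        _ = (R + 1) / δ := by ring
    have hA2 : ε / (4 * δ) + 1 ≤ (ε / 4 + 1) / δ := by
      calc ε / (4 * δ) + 1 ≤ ε / (4 * δ) + 1 / δ := by linarith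
        _ = (ε / 4 + 1) / δ := by
            field_simp
    have hX : (C₀ * (R / δ + 1) ^ 2) ^ 2 ≤ (C₀ * ((R + 1) / δ) ^ 2) ^ 2 :=
      pow_le_pow_left₀ (mul_nonneg hC₀0 (by positivity))
        (mul_le_mul_of_nonneg_left (pow_le_pow_left₀ (by positivity) hA1 2) hC₀0) 2
    have hY : (C₀ * (ε / (4 * δ) + 1) ^ 2) ^ 2 ≤ (C₀ * ((ε / 4 + 1) / δ) ^ 2) ^ 2 :=
      pow_le_pow_left₀ (mul_nonneg hC₀0 (by positivity))
        (mul_le_mul_of_nonneg_left (pow_le_pow_left₀ (by positivity) hA2 2) hC₀0) 2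
    calc (C₀ * (R / δ + 1) ^ 2) ^ 2 *
          (18 * (C₀ * (ε / (4 * δ) + 1) ^ 2) ^ 2 * Real.exp (-(c δ * (ε / (8 * δ)))))
        ≤ (C₀ * ((R + 1) / δ) ^ 2) ^ 2 * (18 * (C₀ * ((ε / 4 + 1) / δ) ^ 2) ^ 2 * δ ^ 10) :=
          mul_le_mul hX (mul_le_mul (mul_le_mul_of_nonneg_left hY (by norm_num)) hexp
            (Real.exp_nonneg _) (by positivity)) (by positivity) (by positivity)
      _ = M * δ ^ 2 := by
          rw [hMdef]
          field_simp
      _ ≤ Real.log (1 + θ) := hMδ.le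
  -- apply the core F2
  exact stub_zloopRatioMixingCore C₀ hC₀ _ _ (SAW.embDomainGraph_le hexGraph hexCenter D.carrier δ)
    hHfin hgeoδ.2.1 (SAW.embMeshDomain hexGraph hexCenter D'.carrier δ)
    (fun u w h => ((SAW.embDomainGraph_adj_iff hexGraph hexCenter).1 h).2.1)
    (closure (D.carrier \ D'.carrier)) δ ε θ _ _ _ hδ (by linarith) hθ hy0 hy1 hc0 hgeoδ.2.2 hrateδ
    hNE hT {v | v ∉ γ₁.walk.support} {v | v ∉ γ₂.walk.support}
    (fun v hv => mix_support_mem γ₁ hab v (not_not.1 hv))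
    (fun v hv => mix_support_mem γ₂ hab v (not_not.1 hv))
    (fun v hv => wn_support_far_of_curve_mem γ₁ hγ₁ v (not_not.1 hv))
    (fun v hv => wn_support_far_of_curve_mem γ₂ hγ₂ v (not_not.1 hv))

end Summit.CriticalPhenomena.SAWScalingLimit.Theorems.MassiveWindowSLE.Birth

end
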